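import Summits.SmoothPoincare4.SmoothPoincare4.Theses.EntropyRung
import Literature.Geometry.Riemannian.CoerciveSchrodingerClosed
import HarnessLib

/-!
# A coercive Schrödinger operator on a closed connected 4-manifold is positively invertible
(stub `stub_coerciveSchrodingerSolve`, line `green-blowup-conformal-entropy`, crux
`EntropyRung.SubcylindricalExistence`, item stmt-SmoothPoincare4-10871)

For a Riemannian metric `g` (Levi-Civita connection) on a closed connected 4-manifold of the
summit binder (model `ℝ⁴ = EuclideanSpace ℝ (Fin 4)`, `I = 𝓡 4`) and a smooth potential `V`,
suppose the Schrödinger form of `−Δ_g + V` is coercive on `C¹` functions: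
`ev ∫ w² dV_g ≤ ∫ (|∇w|²_g + V w²) dV_g` for all `w ∈ C¹(M)` and some `ev > 0`. Then for every
smooth `h > 0` there is a smooth `u > 0` with `−Δ_g u + V u = h` everywhere.

This is, up to the sign convention `Δ_g u − V u = −h` and the spelling
`|∇w|²_g = g.gradSq w = g⁻¹(dw, dw)`, the instance `m = 4` of the tree's theorem
`Literature.Geometry.Lorentzian.exists_smooth_pos_solution_of_coercive`
(`Literature/Geometry/Riemannian/CoerciveSchrodingerClosed.lean`: Lax–Milgram weak solution,
interior regularity à la Folland Cor. (6.34) in charts, positivity by the variational substitute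
for the strong maximum principle of Gursky–LeBrun 1998, Prop. 3), applied to the Mathlib
Riemannian metric `g.toContMDiffRiemannianMetric hg` (whose pseudo-Riemannian metric
`ofRiemannian _` is `g` again, definitionally), `f = V`, source `−h < 0`, constant `c = ev`;
coercivity on `C^∞` functions is the hypothesis restricted from `C¹`. Everything is proved; no
definition, no named fact.

References: D. Gilbarg, N. S. Trudinger, *Elliptic PDE of second order* (2001), Thm. 5.8,
Cor. 8.11 [GilbargTrudinger2001]; M. Gursky, C. LeBrun, GAFA 8 (1998), Prop. 3
[GurskyLebrun1998]; T. Aubin, *Nonlinear analysis on manifolds* (1982), Ch. 4 [Aubin1982].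
-/

noncomputable section

-- the registered namespace `Summit.SmoothPoincare4.SmoothPoincare4.Theorems` repeats a component
set_option linter.dupNamespace false

open scoped Manifold ContDiff Topology ENNReal NNReal
open Set Filter MeasureTheory
open Literature.Geometry.Lorentzian Literature.Geometry.Riemannian

namespace Summit.SmoothPoincare4.SmoothPoincare4.Theorems

/-- **Stub C2 — a coercive Schrödinger operator on a closed connected 4-manifold is positively
invertible on `C^∞`** (registered stub `stub_coerciveSchrodingerSolve` of line
`green-blowup-conformal-entropy`): if `ev ∫ w² ≤ ∫ (|∇w|²_g + V w²)` for all `C¹` functions `w`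
with some `ev > 0`, then for every smooth `h > 0` there is a smooth `u > 0` with
`−Δ_g u + V u = h`. The instance `m = 4`, `I = 𝓡 4`, `f = V`, source `−h`, `c = ev` of
`Literature.Geometry.Lorentzian.exists_smooth_pos_solution_of_coercive` for the Mathlib
Riemannian metric `g.toContMDiffRiemannianMetric hg`.
[cite: GurskyLebrun1998, Prop. 3] [cite: GilbargTrudinger2001, Thm. 5.8 and Cor. 8.11] -/
theorem stub_coerciveSchrodingerSolve :
    ∀ (M : Type) [TopologicalSpace M] [T2Space M] [SecondCountableTopology M]
      [ChartedSpace (EuclideanSpace ℝ (Fin 4)) M] [IsManifold (𝓡 4) ∞ M] [CompactSpace M]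
      [ConnectedSpace M] [T3Space M] [MeasurableSpace M] [BorelSpace M]
      (g : PseudoRiemannianMetric (𝓡 4) ∞ (EuclideanSpace ℝ (Fin 4)) (TangentSpace (𝓡 4) : M → Type _))
      [g.HasLeviCivita] (hg : g.IsRiemannian) (V : M → ℝ), ContMDiff (𝓡 4) 𝓘(ℝ, ℝ) ∞ V →
      (∃ ev : ℝ, 0 < ev ∧ ∀ w : M → ℝ, ContMDiff (𝓡 4) 𝓘(ℝ, ℝ) 1 w →
        ev * ∫ x, w x ^ 2 ∂(riemannianMeasure (g.toContMDiffRiemannianMetric hg)) ≤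
          ∫ x, (g.gradSq w x + V x * w x ^ 2) ∂(riemannianMeasure (g.toContMDiffRiemannianMetric hg))) →
      ∀ h : M → ℝ, ContMDiff (𝓡 4) 𝓘(ℝ, ℝ) ∞ h → (∀ x, 0 < h x) →
        ∃ u : M → ℝ, ContMDiff (𝓡 4) 𝓘(ℝ, ℝ) ∞ u ∧ (∀ x, 0 < u x) ∧
          ∀ x, -g.dalembertian u x + V x * u x = h x := by
  intro M _ _ _ _ _ _ _ _ _ _ g _ hg V hV hcoer h hh hpos
  obtain ⟨ev, hev, hRay⟩ := hcoer
  haveI : Nontrivial (EuclideanSpace ℝ (Fin 4)) := Module.nontrivial_of_finrank_pos (R := ℝ)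
    (by rw [finrank_euclideanSpace_fin]; norm_num)
  -- the Mathlib Riemannian metric of `g`; its pseudo-Riemannian metric is `g` again (by `rfl`)
  set G₀ := g.toContMDiffRiemannianMetric hg
  haveI hLC : (PseudoRiemannianMetric.ofRiemannian G₀).HasLeviCivita := ‹g.HasLeviCivita›
  -- coercivity on smooth functions (`g.gradSq w x` is `g⁻¹(dw, dw)` by definition)
  have hcoer' : ∀ φ : M → ℝ, ContMDiff (𝓡 4) 𝓘(ℝ, ℝ) ∞ φ →
      ev * ∫ x, φ x ^ 2 ∂riemannianMeasure G₀ ≤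
        ∫ x, ((PseudoRiemannianMetric.ofRiemannian G₀).innerDual x
          (mvfderiv (𝓡 4) φ x).toLinearMap (mvfderiv (𝓡 4) φ x).toLinearMap + V x * φ x ^ 2)
          ∂riemannianMeasure G₀ := fun φ hφ ↦
    hRay φ (hφ.of_le (WithTop.coe_le_coe.mpr le_top))
  -- the source `−h` is smooth and negative
  have hneg : ContMDiff (𝓡 4) 𝓘(ℝ, ℝ) ∞ (fun x ↦ -h x) := hh.neg
  have hnegneg : ∀ x, (fun x ↦ -h x) x < 0 := fun x ↦ by simpa using hpos x
  obtain ⟨u, hu, hupos, hueq⟩ :=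
    exists_smooth_pos_solution_of_coercive G₀ hV hneg hnegneg hev hcoer'
  refine ⟨u, hu, hupos, fun x ↦ ?_⟩
  have hx : g.dalembertian u x - V x * u x = -h x := hueq x
  linarith

end Summit.SmoothPoincare4.SmoothPoincare4.Theorems

end
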